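import Mathlib
import Summits.Parity.BatemanHorn.Theses.PolynomialMobius
import Summits.Parity.BatemanHorn.Theses.IsogenyRedei
import Summits.Parity.BatemanHorn.Theorems.PolynomialMobiusPolyMobiusTailStubWindowLinearLeOne
import Summits.Parity.BatemanHorn.Theorems.PolynomialMobiusPolyMobiusTailWindowLinearPair
import Summits.Parity.BatemanHorn.Theorems.PolynomialMobiusPolyMobiusTailLargeLocalisation
import Summits.Parity.BatemanHorn.Theorems.PolynomialMobiusPolyMobiusTailStubDegreeOneTail
import Summits.Parity.BatemanHorn.Theorems.PolynomialMobiusPolyMobiusTailStubWindowEqTailEventually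
import Summits.Parity.BatemanHorn.Theorems.PolynomialMobiusPolyMobiusTailLargeBandLowDegree

/-!
# Crux stmt-Parity-0870 `PolyMobiusTail` — registered sub-skeleton of the piece
# `stub_window_linear_le_one` (window, `k ≤ 1` linear systems) + the crux skeleton it sits in

## v5 (lead `prover-line-stmt-Parity-0870-c5-0`, 2026-08-17T10–11Z): §A DISCHARGED (P1, P2 landed); S4 RESHAPED core ∧ band (S4c landed)

* P1 `stub_degreeOne_tail` LANDED p153674 as
  `Summit.Parity.BatemanHorn.Theorems.PolyMobiusTail.EtaFreeWindow.stub_degreeOne_tail`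
  (`Theorems/PolynomialMobiusPolyMobiusTailStubDegreeOneTail.lean`);
* P2 `stub_window_eq_tail_eventually` LANDED p153676 as
  `Summit.Parity.BatemanHorn.Theorems.PolyMobiusTail.EtaFreeWindow.stub_window_eq_tail_eventually`
  (`Theorems/PolynomialMobiusPolyMobiusTailStubWindowEqTailEventually.lean`; any `θ > 0`, any `η`).
Both are consumed BY NAME below (the §A theorems keep their registered signatures, proofs = the landed
decls).  In §B the v4 stub `stub_large` (S4) is RESHAPED along census gen 4 D20 with the coupling `δ < θ`:
S4a `stub_large_core` (complete cofactor pencils `∏eᵢ ≤ x^{1-δ}` — the parity core proper, the PROMOTION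
TARGET), S4b `stub_large_band_three_le` (hyper-incomplete band, total degree `G ≥ 3` only), S4c
`stub_large_band_le_two` (band EMPTY for `G ≤ 2`, LANDED p154483 as `…EtaFreeWindow.stub_large_band_le_two`),
with `large_of_core_band` (PROVED) recovering the v4 `stub_large` signature verbatim.  So the sorries of
this file are now EXACTLY four: `stub_window_linear_three_le` (S2: `k ≥ 3` linear window — balanced cyclic
Kloosterman fractions / Goldston–Yıldırım `O(R³)` barrier, not in print), `stub_window_nonlinear` (S3:
blocked on the open items stmt-Parity-12214 / 12215 of route GaussianFractions; degree ≥ 3 tool-less),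
`stub_large_core` (S4a: the parity core; on every linear pair ⟺ the Hardy–Littlewood pair asymptotic in
cofactor-Möbius form, by p138374 + p148167 + p154483), `stub_large_band_three_le` (S4b: open even with
`μ ↦ 1`).  Nothing else changed (registrar's text below kept verbatim).

Planner `planner-skel-stmt-Parity-0870-stub_window_line-0` (skeleton registrar, 2026-08-17), on the
route-reaudit instruction "bare side of a bridge split: the OPEN piece `stub_window_linear_le_one` has no
registered skeleton or live line".

## STATUS OF THE PIECE — it is CLOSED (landed, sorry-free)

`stub_window_linear_le_one` was stub S1a of the crux line `eta-free-multilinear-window`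
(`Lines/eta_free_multilinear_window.lean`, skeleton v2 @0811b8c6 → v3 → v4 @d41812694c8f).  It was PROVED
by worker W1 of lead c3 and landed as p138278:

  `Summit.Parity.BatemanHorn.Theorems.PolyMobiusTail.EtaFreeWindow.stub_window_linear_le_one`
  (file `Summits/Parity/BatemanHorn/Theorems/PolynomialMobiusPolyMobiusTailStubWindowLinearLeOne.lean`).

Skeleton v4 consumes it by name (`window_linear_le_one`), so it is no longer a sorried stub there and its
stub record was archived by the gate — which is why the re-audit saw "no registered skeleton or live line"
for it.  The `example` right after `WindowLinearLeOne` below certifies, by elaboration, that the piece as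
typed here is verbatim the landed theorem.

## What this file registers (so that the piece has "a plan" on record, and nothing live is lost)

§A  The piece BY NAME, `WindowLinearLeOne : Prop` (verbatim signature of `stub_window_linear_le_one`),
    its two-piece decomposition — exactly the two inputs of the landed proof —
    * `stub_degreeOne_tail`           (P1, M): for a ONE-member system of degree ≤ 1 (hence = 1), the FULL
      Möbius tail at cut `x^{1-η}` is `o(x)` for EVERY `η ∈ (0,1)` — the prime number theorem for `μ·log`
      in arithmetic progressions; dischargeable now by `IsBatemanHornSystem.natDegree_pos` +
      `…Theorems.PolyMobiusTail.NaturalForm.stub_degreeOneSlice` (p114749);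
    * `stub_window_eq_tail_eventually` (P2, S/M, folklore): for `k ≤ 1` members of degree ≤ 1 and any
      `θ > 0`, the upper cut `∏ dᵢ ≤ x^{1+θ}` is eventually vacuous on the support (`d ∣ f(n) ≤ B·n ≤ B·x`),
      so the window function EQUALS the tail function eventually (pure size, no BH axiom);
    and the composition `WindowLinearLeOne_of : WindowLinearLeOne` (real proof: `θ = η = 1/2`, case split
    `k = 0` — the empty tuple, `∏∅ = 1 ≤ x^{1/2}` — versus `k = 1`, `IsLittleO.congr'`).
§B  The crux-level skeleton UNCHANGED IN CONTENT from v4: the three OPEN registered stubs of the live line,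
    verbatim (names and signatures identical to the records on stmt-Parity-0870 — they must stay registered):
    `stub_window_linear_three_le` (S2), `stub_window_nonlinear` (S3), `stub_large` (S4, the parity core);
    the landed pair window `…EtaFreeWindow.stub_window_linear_pair` (p148167) by name; and the composition
    `PolyMobiusTail_of : …Theses.PolynomialMobius.PolyMobiusTail` (crux BY NAME) via the landed localisation
    `…EtaFreeWindow.tail_slice_of_window_of_large` (p138374).  Twin for the identical IsogenyRedei decl.

Sorries (registrar's v1): exactly the five `stub_*` theorems (P1, P2 dischargeable today; S2, S3, S4 open as
documented in `Lines/eta_free_multilinear_window.lean` and `Lines/eta_free_multilinear_window_REPORT-c3.md`).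
Sorries (v5, lead c5): exactly S2, S3, S4a, S4b — P1/P2/S4c landed (p153674 / p153676 / p154483), consumed by name.

Disproof used (`Cruxes/PolyMobiusTail/Disproof.lean`): `polyMobiusTail_false_without_nonAssoc` — the only
`_false_without_` theorem — concerns dropping `pairwise_not_associated`; every stub here that needs a BH
axiom keeps the full `IsBatemanHornSystem` hypothesis (P1 uses `hasNoFixedPrimeDivisor` for `gcd(q,a)=1`
and irreducibility for non-constancy; P2 uses none and claims none).  Landed Negative lemmas checked:
`polyMobiusTail_tight_at_eta_one` / `polyMobiusTail_allEtaClosed_false` (P1 keeps `η < 1` OPEN-ended),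
`polyMobiusTail_abs_false` (P1 is a signed sum), `polyMobiusTail_primeDivisors_false` (all divisor tuples).

Per-stub probes (BC3; minimal imports, `first | exact? | simpa | unfold; simpa | aesop`, run by the
registrar, see `Lines/stub_window_linear_le_one.md`): `P1 → piece`, `P2 → piece`, `P1 → BatemanHorn`,
`P2 → BatemanHorn`, `piece → BatemanHorn` all FAIL.
-/

open scoped BigOperators Topology
open Filter Finset Polynomial Asymptotics

namespace Summit.Parity.BatemanHorn.Cruxes.PolyMobiusTail.StubWindowLinearLeOne

open Literature.NumberTheory.Sieve

/-! ## §A  The piece `stub_window_linear_le_one`, BY NAME, and its registered two-stub decomposition -/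

/-- **The piece** (S1a of line `eta-free-multilinear-window`), verbatim: for a Bateman–Horn system of at
most one member, of degree ≤ 1, SOME window `(x^{1-η}, x^{1+θ}]` of the Möbius tail is `o(x)`. -/
def WindowLinearLeOne : Prop :=
  ∀ (k : ℕ) (f : Fin k → ℤ[X]), IsBatemanHornSystem f → k ≤ 1 → (∀ i, (f i).natDegree ≤ 1) →
    ∃ θ : ℝ, 0 < θ ∧ θ < 1 ∧ ∃ η : ℝ, 0 < η ∧ η < 1 ∧
      (fun x : ℕ => ∑ n ∈ Finset.Icc 1 x,
        ∑ d ∈ Fintype.piFinset (fun i => (((f i).eval (n : ℤ)).toNat).divisors),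
          if (x : ℝ) ^ (1 - η) < ∏ i, (d i : ℝ) ∧ ∏ i, (d i : ℝ) ≤ (x : ℝ) ^ (1 + θ) then
            ∏ i, ((ArithmeticFunction.moebius (d i) : ℝ) * Real.log (d i)) else 0)
        =o[atTop] fun x : ℕ => (x : ℝ)

/-- CERTIFICATE: the piece is CLOSED — it is, verbatim, the landed theorem p138278 (an `example`, so that
it does not compete with `WindowLinearLeOne_of` as the skeleton theorem). -/
example : WindowLinearLeOne :=
  Summit.Parity.BatemanHorn.Theorems.PolyMobiusTail.EtaFreeWindow.stub_window_linear_le_one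

/-- **P1 · `stub_degreeOne_tail` — the Möbius tail of a ONE-member linear system is `o(x)` at EVERY
`η ∈ (0,1)`.**  For `f = (f₀)` a Bateman–Horn system with `deg f₀ ≤ 1` (so `f₀ = qX + a`, `q ≥ 1`,
`gcd(q,a) = 1`: degree `0` is excluded by `IsBatemanHornSystem.natDegree_pos`, a positive irreducible
constant being a fixed prime divisor) and every `0 < η < 1`,
`Σ_{n≤x} Σ_{d ∣ f₀(n), x^{1-η} < d} μ(d) log d = o(x)`.
Why true: `Σ_{n≤x} Λ(qn+a) ∼ (q/φ(q))x` (PNT in progressions) minus the Type-I part `∼ C(f)x` with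
`C(f) = q/φ(q)`; LANDED in `Fin 1`/`natDegree = 1` form as
`Summit.Parity.BatemanHorn.Theorems.PolyMobiusTail.NaturalForm.stub_degreeOneSlice` (p114749) — discharge:
`fun f hf hd => NaturalForm.stub_degreeOneSlice f hf (le_antisymm hd (hf.natDegree_pos 0))`.
`η < 1` is sharp (`Negative.polyMobiusTail_tight_at_eta_one`). Size: M (landed).
**v5: LANDED p153674** — proof = `EtaFreeWindow.stub_degreeOne_tail` (lead c5). -/
theorem stub_degreeOne_tail : ∀ (f : Fin 1 → ℤ[X]), IsBatemanHornSystem f → (f 0).natDegree ≤ 1 →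
    ∀ η : ℝ, 0 < η → η < 1 →
      (fun x : ℕ => ∑ n ∈ Finset.Icc 1 x,
        ∑ d ∈ Fintype.piFinset (fun i => (((f i).eval (n : ℤ)).toNat).divisors),
          if (x : ℝ) ^ (1 - η) < ∏ i, (d i : ℝ) then
            ∏ i, ((ArithmeticFunction.moebius (d i) : ℝ) * Real.log (d i)) else 0)
        =o[atTop] fun x : ℕ => (x : ℝ) :=
  Summit.Parity.BatemanHorn.Theorems.PolyMobiusTail.EtaFreeWindow.stub_degreeOne_tail

/-- **P2 · `stub_window_eq_tail_eventually` — for `k ≤ 1` linear members the upper cut is eventually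
vacuous: window = tail eventually.**  For `k ≤ 1`, members of degree ≤ 1, ANY `θ > 0` and any `η`:
eventually in `x`, `Σ_{n≤x} Σ_{dᵢ∣fᵢ(n)} [x^{1-η} < ∏dᵢ ≤ x^{1+θ}]·w(d) = Σ_{n≤x} Σ_{dᵢ∣fᵢ(n)} [x^{1-η} < ∏dᵢ]·w(d)`.
Why true: `k = 0`: the only tuple is the empty one, `∏∅ = 1 ≤ x^{1+θ}` for `x ≥ 1` (and `x = 0` has no
`n`); `k = 1`: a divisor `d ∣ f₀(n)⁺`, `1 ≤ n ≤ x`, has `d ≤ f₀(n)⁺ ≤ B·n ≤ B·x ≤ x^{1+θ}` once `x^θ ≥ B`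
(`B = Σ|coeffs|`, `Negative.toNat_eval_le_mul_pow`).  No Bateman–Horn axiom needed (pure size).
Size: S/M (folklore; the landed file proves the `θ = 1/2` instance inline).
**v5: LANDED p153676** — proof = `EtaFreeWindow.stub_window_eq_tail_eventually` (lead c5). -/
theorem stub_window_eq_tail_eventually : ∀ (k : ℕ) (f : Fin k → ℤ[X]), k ≤ 1 →
    (∀ i, (f i).natDegree ≤ 1) → ∀ θ η : ℝ, 0 < θ →
      (fun x : ℕ => ∑ n ∈ Finset.Icc 1 x,
        ∑ d ∈ Fintype.piFinset (fun i => (((f i).eval (n : ℤ)).toNat).divisors),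
          if (x : ℝ) ^ (1 - η) < ∏ i, (d i : ℝ) ∧ ∏ i, (d i : ℝ) ≤ (x : ℝ) ^ (1 + θ) then
            ∏ i, ((ArithmeticFunction.moebius (d i) : ℝ) * Real.log (d i)) else 0)
        =ᶠ[atTop]
      (fun x : ℕ => ∑ n ∈ Finset.Icc 1 x,
        ∑ d ∈ Fintype.piFinset (fun i => (((f i).eval (n : ℤ)).toNat).divisors),
          if (x : ℝ) ^ (1 - η) < ∏ i, (d i : ℝ) then
            ∏ i, ((ArithmeticFunction.moebius (d i) : ℝ) * Real.log (d i)) else 0) :=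
  Summit.Parity.BatemanHorn.Theorems.PolyMobiusTail.EtaFreeWindow.stub_window_eq_tail_eventually

/-- **Composition of the piece (PROVED): `P1 ∧ P2 ⟹ stub_window_linear_le_one`.**  Take `θ = η = 1/2`.
`k = 0`: the tail at cut `x^{1/2}` vanishes for `x ≥ 1` (`∏∅ = 1 ≤ x^{1/2}`), so it is `o(x)`, and the
window equals it eventually (P2).  `k = 1`: the tail is `o(x)` by P1 and the window equals it eventually
(P2); `IsLittleO.congr'`. -/
theorem WindowLinearLeOne_of : WindowLinearLeOne := by
  intro k f hf hk hdeg
  refine ⟨1 / 2, by norm_num, by norm_num, 1 / 2, by norm_num, by norm_num, ?_⟩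
  have hEq := stub_window_eq_tail_eventually k f hk hdeg (1 / 2) (1 / 2) (by norm_num)
  obtain rfl | rfl : k = 0 ∨ k = 1 := by omega
  · -- `k = 0`: the tail is eventually `0`
    refine IsLittleO.congr' ?_ hEq.symm EventuallyEq.rfl
    refine (isLittleO_zero (fun x : ℕ => (x : ℝ)) atTop).congr' ?_ EventuallyEq.rfl
    filter_upwards [eventually_ge_atTop 1] with x hx
    symm
    refine Finset.sum_eq_zero fun n _ => Finset.sum_eq_zero fun d _ => ?_
    rw [if_neg]
    intro h
    rw [Finset.univ_eq_empty, Finset.prod_empty] at h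
    exact absurd h (not_lt.mpr (Real.one_le_rpow (by exact_mod_cast hx) (by norm_num)))
  · -- `k = 1`: P1 at `η = 1/2`, transported to the window by P2
    have htail := stub_degreeOne_tail f hf (hdeg 0) (1 / 2) (by norm_num) (by norm_num)
    exact htail.congr' hEq.symm EventuallyEq.rfl

/-! ## §B  The crux skeleton the piece sits in (content = v4 of line `eta-free-multilinear-window`)

The three OPEN stubs below are VERBATIM the registered stubs of skeleton v4
(`Lines/eta_free_multilinear_window.lean` @d41812694c8f, lead c3); their docstrings there are authoritative
(S2: trilinear Kloosterman fractions, not in print; S3: root Type II beyond level 1/2, stmt-Parity-12215 +;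
S4: the parity core, crux-sized by `stub_large_iff_tail_of_window` p138374).  They are repeated here only so
that registering this file keeps them registered. -/

/-- **S2 · WINDOW, linear systems with `k ≥ 3` (open, parity-free)** — verbatim from skeleton v4. -/
theorem stub_window_linear_three_le : ∀ (k : ℕ) (f : Fin k → ℤ[X]), IsBatemanHornSystem f → 3 ≤ k →
    (∀ i, (f i).natDegree ≤ 1) →
    ∃ θ : ℝ, 0 < θ ∧ θ < 1 ∧ ∃ η : ℝ, 0 < η ∧ η < 1 ∧
      (fun x : ℕ => ∑ n ∈ Finset.Icc 1 x,
        ∑ d ∈ Fintype.piFinset (fun i => (((f i).eval (n : ℤ)).toNat).divisors),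
          if (x : ℝ) ^ (1 - η) < ∏ i, (d i : ℝ) ∧ ∏ i, (d i : ℝ) ≤ (x : ℝ) ^ (1 + θ) then
            ∏ i, ((ArithmeticFunction.moebius (d i) : ℝ) * Real.log (d i)) else 0)
        =o[atTop] fun x : ℕ => (x : ℝ) := by
  sorry

/-- **S3 · WINDOW, systems with a member of degree ≥ 2 (open, parity-free)** — verbatim from skeleton v4. -/
theorem stub_window_nonlinear : ∀ (k : ℕ) (f : Fin k → ℤ[X]), IsBatemanHornSystem f →
    (∃ i, 2 ≤ (f i).natDegree) →
    ∃ θ : ℝ, 0 < θ ∧ θ < 1 ∧ ∃ η : ℝ, 0 < η ∧ η < 1 ∧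
      (fun x : ℕ => ∑ n ∈ Finset.Icc 1 x,
        ∑ d ∈ Fintype.piFinset (fun i => (((f i).eval (n : ℤ)).toNat).divisors),
          if (x : ℝ) ^ (1 - η) < ∏ i, (d i : ℝ) ∧ ∏ i, (d i : ℝ) ≤ (x : ℝ) ^ (1 + θ) then
            ∏ i, ((ArithmeticFunction.moebius (d i) : ℝ) * Real.log (d i)) else 0)
        =o[atTop] fun x : ℕ => (x : ℝ) := by
  sorry

/-! ### S4 reshaped (v5, lead c5): `stub_large` = CORE (complete pencils) ∧ BAND (hyper-incomplete)

Census gen 4 D20 (`Cruxes/PolyMobiusTail/StrategyCensusGen4.lean`: `CoreComplete`, `HyperIncompleteBand`,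
glue `largeAll_of_core_band` with `δ = 1/2`) recommends promoting the CORE, not `stub_large` verbatim,
because for total degree `G ≥ 3` the large part silently contains a band that is open even with every
`μ` replaced by `1` (triple-divisor-type correlations at the Pólya–Vinogradov threshold).  v5 makes that
split the REGISTERED shape of S4, with one correction: the cofactor cut `∏ eᵢ ≤ x^{1-δ}` is COUPLED to
the divisor cut by `δ < θ` (D20's fixed `δ = 1/2` would put pencils of length `x^{θ} … x^{1/2}` of a
linear PAIR into the "band", which is core material).  With `δ < θ`:
* CORE (S4a `stub_large_core`): tuples with `∏ eᵢ ≤ x^{1-δ}` — every pencil `n ≡ r (mod ∏eᵢ)` has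
  `≥ x^{δ}` terms: the parity core proper (Möbius along polynomial pencils WITH level and rate).
* BAND (S4b `stub_large_band_three_le`): `∏ eᵢ > x^{1-δ}` AND `∏ dᵢ > x^{1+θ}` force
  `∏ fᵢ(n) > x^{2+θ-δ}`, impossible for `G ≤ 2` eventually (S4c `stub_large_band_le_two`, LANDED by
  lead c5), so the open band is registered for `G ≥ 3` only, where it has full logarithmic measure.
* `large_of_core_band` (PROVED): S4a ∧ S4b ∧ S4c ⟹ the v4 `stub_large` signature verbatim (`δ := θ/2`). -/

/-- **S4a · `stub_large_core` — the parity CORE: large divisor part restricted to COMPLETE cofactor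
pencils (open; every system; = census D20 `CoreComplete` with the coupling `δ < θ`).**  For every
Bateman–Horn system and `0 < δ < θ < 1`:
`Σ_{n≤x} Σ_{eᵢ ∣ fᵢ(n), ∏ fᵢ(n)/eᵢ > x^{1+θ}, ∏ eᵢ ≤ x^{1-δ}} ∏ μ(fᵢ(n)/eᵢ) log(fᵢ(n)/eᵢ) = o(x)`.
Grouped by the cofactor tuple `e` (`∏eᵢ ≤ x^{1-δ}`) this is Möbius cancellation of the large cofactors
along the pencils `n ≡ r (mod ∏eᵢ)` of length `≥ x^{δ}` through the roots of `f` — the parity statement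
proper (Selberg/Bombieri indeterminacy lives here; on a linear pair it is the Hardy–Littlewood pair
asymptotic in cofactor-Möbius form, p138374 + p148167).  THIS is the promotion target (census gen 4 §2). -/
theorem stub_large_core : ∀ (k : ℕ) (f : Fin k → ℤ[X]), IsBatemanHornSystem f → ∀ θ δ : ℝ,
    0 < θ → θ < 1 → 0 < δ → δ < θ →
    (fun x : ℕ => ∑ n ∈ Finset.Icc 1 x,
      ∑ e ∈ Fintype.piFinset (fun i => (((f i).eval (n : ℤ)).toNat).divisors),
        if (x : ℝ) ^ (1 + θ) < ∏ i, ((((f i).eval (n : ℤ)).toNat / e i : ℕ) : ℝ) ∧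
            ∏ i, (e i : ℝ) ≤ (x : ℝ) ^ (1 - δ) then
          ∏ i, ((ArithmeticFunction.moebius (((f i).eval (n : ℤ)).toNat / e i) : ℝ) *
            Real.log ((((f i).eval (n : ℤ)).toNat / e i : ℕ) : ℝ)) else 0)
      =o[atTop] fun x : ℕ => (x : ℝ) := by
  sorry

/-- **S4b · `stub_large_band_three_le` — the HYPER-INCOMPLETE BAND, total degree `G ≥ 3` (open,
parity-free in kind; = census D20 `HyperIncompleteBand` with `δ < θ`, restricted to the systems where
the band is non-empty).**  For every Bateman–Horn system with `∑ deg fᵢ ≥ 3` and `0 < δ < θ < 1`: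
`Σ_{n≤x} Σ_{eᵢ ∣ fᵢ(n), ∏ fᵢ(n)/eᵢ > x^{1+θ}, ∏ eᵢ > x^{1-δ}} ∏ μ(fᵢ(n)/eᵢ) log(fᵢ(n)/eᵢ) = o(x)`.
Here both factorisation sides exceed `x^{1∓…}`: cofactor pencils have `< x^{δ}` terms (mostly `≤ 1` term
once `∏eᵢ > x`) and divisor moduli exceed `x^{1+θ}` — no complete variable on either side.  Open even
with `μ ↦ 1` (Blomer, Bull. LMS 49 (2017), triple divisor correlations); census gen 4 D20 / T12. -/
theorem stub_large_band_three_le : ∀ (k : ℕ) (f : Fin k → ℤ[X]), IsBatemanHornSystem f →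
    3 ≤ ∑ i, (f i).natDegree → ∀ θ δ : ℝ, 0 < θ → θ < 1 → 0 < δ → δ < θ →
    (fun x : ℕ => ∑ n ∈ Finset.Icc 1 x,
      ∑ e ∈ Fintype.piFinset (fun i => (((f i).eval (n : ℤ)).toNat).divisors),
        if (x : ℝ) ^ (1 + θ) < ∏ i, ((((f i).eval (n : ℤ)).toNat / e i : ℕ) : ℝ) ∧
            (x : ℝ) ^ (1 - δ) < ∏ i, (e i : ℝ) then
          ∏ i, ((ArithmeticFunction.moebius (((f i).eval (n : ℤ)).toNat / e i) : ℝ) *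
            Real.log ((((f i).eval (n : ℤ)).toNat / e i : ℕ) : ℝ)) else 0)
      =o[atTop] fun x : ℕ => (x : ℝ) := by
  sorry

/-- **S4c · `stub_large_band_le_two` — the band is EMPTY for total degree `G ≤ 2` (LANDED by lead c5 as
`…Theorems.PolyMobiusTail.EtaFreeWindow.stub_large_band_le_two`, file
`Theorems/PolynomialMobiusPolyMobiusTailLargeBandLowDegree.lean`; pure size, no BH axiom).**  If
`∑ deg fᵢ ≤ 2` and `δ < θ` then eventually no pair `(n, e)` with `1 ≤ n ≤ x`, `eᵢ ∣ fᵢ(n)⁺` satisfies both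
`x^{1+θ} < ∏ fᵢ(n)⁺/eᵢ` and `x^{1-δ} < ∏ eᵢ`: multiplying, `x^{2+θ-δ} < ∏ (fᵢ(n)⁺/eᵢ)·eᵢ ≤ ∏ fᵢ(n)⁺ ≤
(∏ᵢ Σⱼ|aᵢⱼ|)·x²`, false once `x^{θ-δ} > ∏ᵢ Σⱼ|aᵢⱼ|`.  So on linear pairs and on one quadratic the whole large
part is CORE. [folklore] -/
theorem stub_large_band_le_two : ∀ (k : ℕ) (f : Fin k → ℤ[X]), ∑ i, (f i).natDegree ≤ 2 →
    ∀ θ δ : ℝ, δ < θ →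
    (fun x : ℕ => ∑ n ∈ Finset.Icc 1 x,
      ∑ e ∈ Fintype.piFinset (fun i => (((f i).eval (n : ℤ)).toNat).divisors),
        if (x : ℝ) ^ (1 + θ) < ∏ i, ((((f i).eval (n : ℤ)).toNat / e i : ℕ) : ℝ) ∧
            (x : ℝ) ^ (1 - δ) < ∏ i, (e i : ℝ) then
          ∏ i, ((ArithmeticFunction.moebius (((f i).eval (n : ℤ)).toNat / e i) : ℝ) *
            Real.log ((((f i).eval (n : ℤ)).toNat / e i : ℕ) : ℝ)) else 0)
      =o[atTop] fun x : ℕ => (x : ℝ) :=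
  Summit.Parity.BatemanHorn.Theorems.PolyMobiusTail.EtaFreeWindow.stub_large_band_le_two

/-- **S4 · LARGE PART in cofactor form (the v4 signature of `stub_large`, verbatim) — now DERIVED
(PROVED) from S4a (core), S4b (band, `G ≥ 3`) and the landed S4c (band empty, `G ≤ 2`) with
`δ := θ/2`.**  Additive split of the cofactor range at `∏ eᵢ ≤ x^{1-θ/2}`. -/
theorem large_of_core_band : ∀ (k : ℕ) (f : Fin k → ℤ[X]), IsBatemanHornSystem f → ∀ θ : ℝ,
    0 < θ → θ < 1 →
    (fun x : ℕ => ∑ n ∈ Finset.Icc 1 x,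
      ∑ e ∈ Fintype.piFinset (fun i => (((f i).eval (n : ℤ)).toNat).divisors),
        if (x : ℝ) ^ (1 + θ) < ∏ i, ((((f i).eval (n : ℤ)).toNat / e i : ℕ) : ℝ) then
          ∏ i, ((ArithmeticFunction.moebius (((f i).eval (n : ℤ)).toNat / e i) : ℝ) *
            Real.log ((((f i).eval (n : ℤ)).toNat / e i : ℕ) : ℝ)) else 0)
      =o[atTop] fun x : ℕ => (x : ℝ) := by
  intro k f hf θ hθ0 hθ1
  have hδ0 : (0 : ℝ) < θ / 2 := by linarith
  have hδθ : θ / 2 < θ := by linarith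
  have h1 := stub_large_core k f hf θ (θ / 2) hθ0 hθ1 hδ0 hδθ
  have h2 : (fun x : ℕ => ∑ n ∈ Finset.Icc 1 x,
      ∑ e ∈ Fintype.piFinset (fun i => (((f i).eval (n : ℤ)).toNat).divisors),
        if (x : ℝ) ^ (1 + θ) < ∏ i, ((((f i).eval (n : ℤ)).toNat / e i : ℕ) : ℝ) ∧
            (x : ℝ) ^ (1 - θ / 2) < ∏ i, (e i : ℝ) then
          ∏ i, ((ArithmeticFunction.moebius (((f i).eval (n : ℤ)).toNat / e i) : ℝ) *
            Real.log ((((f i).eval (n : ℤ)).toNat / e i : ℕ) : ℝ)) else 0)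
      =o[atTop] fun x : ℕ => (x : ℝ) := by
    by_cases hG : ∑ i, (f i).natDegree ≤ 2
    · exact stub_large_band_le_two k f hG θ (θ / 2) hδθ
    · exact stub_large_band_three_le k f hf (by omega) θ (θ / 2) hθ0 hθ1 hδ0 hδθ
  refine (h1.add h2).congr_left fun x => ?_
  rw [← Finset.sum_add_distrib]
  refine Finset.sum_congr rfl fun n _ => ?_
  rw [← Finset.sum_add_distrib]
  refine Finset.sum_congr rfl fun e _ => ?_
  by_cases hA : (x : ℝ) ^ (1 + θ) < ∏ i, ((((f i).eval (n : ℤ)).toNat / e i : ℕ) : ℝ)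
  · by_cases hle : ∏ i, (e i : ℝ) ≤ (x : ℝ) ^ (1 - θ / 2)
    · rw [if_pos hA, if_pos ⟨hA, hle⟩, if_neg (fun h => (not_lt.mpr hle) h.2), add_zero]
    · rw [if_pos hA, if_neg (fun h => hle h.2), if_pos ⟨hA, not_le.mp hle⟩, zero_add]
  · rw [if_neg hA, if_neg (fun h => hA h.1), if_neg (fun h => hA h.1), add_zero]

/-- Some window of every Bateman–Horn system is `o(x)` — case split over the piece (`k ≤ 1` linear, §A),
the LANDED pair window (`k = 2` linear, p148167), S2 (`k ≥ 3` linear) and S3 (a nonlinear member). -/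
theorem window_of_pieces {k : ℕ} (f : Fin k → ℤ[X]) (hf : IsBatemanHornSystem f) :
    ∃ θ : ℝ, 0 < θ ∧ θ < 1 ∧ ∃ η : ℝ, 0 < η ∧ η < 1 ∧
      (fun x : ℕ => ∑ n ∈ Finset.Icc 1 x,
        ∑ d ∈ Fintype.piFinset (fun i => (((f i).eval (n : ℤ)).toNat).divisors),
          if (x : ℝ) ^ (1 - η) < ∏ i, (d i : ℝ) ∧ ∏ i, (d i : ℝ) ≤ (x : ℝ) ^ (1 + θ) then
            ∏ i, ((ArithmeticFunction.moebius (d i) : ℝ) * Real.log (d i)) else 0)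
        =o[atTop] fun x : ℕ => (x : ℝ) := by
  by_cases hlin : ∀ i, (f i).natDegree ≤ 1
  · by_cases hk : k ≤ 1
    · exact WindowLinearLeOne_of k f hf hk hlin
    · by_cases hk2 : k = 2
      · exact Summit.Parity.BatemanHorn.Theorems.PolyMobiusTail.EtaFreeWindow.stub_window_linear_pair
          k f hf hk2 hlin
      · exact stub_window_linear_three_le k f hf (by omega) hlin
  · push Not at hlin
    obtain ⟨i, hi⟩ := hlin
    exact stub_window_nonlinear k f hf ⟨i, by omega⟩

/-- **Composition (PROVED).** The crux of route PolynomialMobius, BY NAME: for every system take the window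
of `window_of_pieces` at `(η, θ)` and the cofactor large part at `θ` (S4a core ∧ S4b band, via
`large_of_core_band`); the landed localisation `tail_slice_of_window_of_large` (p138374:
`Tail_η = Win_{η,θ} + Large_θ`, divisor switch) gives the `f`-slice of `PolyMobiusTail`. -/
theorem PolyMobiusTail_of : Summit.Parity.BatemanHorn.Theses.PolynomialMobius.PolyMobiusTail := by
  intro k f hf
  obtain ⟨θ, hθ0, hθ1, η, hη0, hη1, hW⟩ := window_of_pieces f hf
  exact Summit.Parity.BatemanHorn.Theorems.PolyMobiusTail.EtaFreeWindow.tail_slice_of_window_of_large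
    f hη0 hη1 hθ0.le hW (large_of_core_band k f hf θ hθ0 hθ1)

/-- The identical decl of route IsogenyRedei (and, verbatim, CyclotomicTower / CrossedSalie /
GaussianFractions — the five routes sharing stmt-Parity-0870). -/
theorem PolyMobiusTail_of_isogenyRedei : Summit.Parity.BatemanHorn.Theses.IsogenyRedei.PolyMobiusTail :=
  PolyMobiusTail_of

end Summit.Parity.BatemanHorn.Cruxes.PolyMobiusTail.StubWindowLinearLeOne
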